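import Literature.AlgebraicGeometry.Hyperkaehler.K3HilbertType
import Literature.AlgebraicGeometry.Motives.Jacobian
import HarnessLib

/-!
# Hyperkähler manifolds of generalized Kummer type (`Kumⁿ`-type)

Layer `Literature/AlgebraicGeometry/Hyperkaehler`. Definition request D1 of the Hodge-ladder stage-4
scoping (run/shared/lean/pub/hodge-director/STAGE4-ABELIAN-MOTIVIC-TYPE.md §10): the predicate
"`X` is of `Kumⁿ`-type" — `X` is deformation equivalent to Beauville's generalized Kummer variety
`Kⁿ(A) ⊂ A^[n+1]` of an abelian surface `A` — so that the printed Hodge-conjecture THEOREMS for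
`Kum²`- and `Kum³`-type (Floccari–Varesco 2024 Cor. 1.2; Floccari 2023 Thm. 1.1) can be recorded on the
tree's real carriers, exactly as `IsOfK3HilbertType` (file `K3HilbertType`) serves Markman 2024.

## Sources (read; PDF pages of the materialised texts)

* A. Beauville, *Variétés kählériennes dont la première classe de Chern est nulle*, J. Differential
  Geom. 18 (1983), §7 p. 769 (PDF p. 15), verbatim: "Soient maintenant `A` un tore complexe de
  dimension `2`, et `r` un entier positif. […] Considérons l'application `s : A^(r+1) → A` définie par
  `s([p₀] + … + [p_r]) = Σ pᵢ`. Par composition avec `ε` [the Hilbert–Chow morphism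
  `A^[r+1] → A^(r+1)`] on en déduit un morphisme `S : A^[r+1] → A`. Observons que le groupe `A` agit
  sur `A^[r+1]` par translations, et sur `A` par la loi d'opération `(t, x) ↦ x + (r + 1)t`;
  l'application `S` est équivariante par rapport à ces deux actions. Il en résulte que `S` est lisse
  et que ses fibres sont isomorphes entre elles. On note `K_r` la variété lisse `S⁻¹(0)`. On
  remarquera que `K₁` n'est autre que la surface de Kummer associée à `A`." Footnote 2 (same page):
  "Plus précisément, le morphisme `S` est « isotrivial »: on a un diagramme cartésien
  `A × K_r → A^[r+1]` au-dessus de `(r+1) : A → A`." Proof of Prop. 8 (same page): "l'homomorphisme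
  `S_* : π₁(A^[r+1]) → π₁(A)` est bijectif" (so `S` induces an isomorphism on `H₁(·, ℤ)`: `S` is the
  Albanese map of `A^[r+1]`). Prop. 7 (p. 769): `K_r` is holomorphic symplectic; Prop. 8: `K_r` is
  simply connected and, for `r ≥ 2`, `H²(K_r, ℂ) = j(H²(A, ℂ)) ⊕ ℂ·[F]`; Théorème 4 (p. 771, PDF
  p. 17): "Soit `A` un tore complexe (de dimension `2`) générique [the generic tori include the abelian
  surfaces, loc. cit.]. Alors la variété `K_r` associée à `A` est une variété kählérienne symplectique
  irréductible, de dimension `2r`"; Remarque (p. 771): `b₂(K_r) = 7`.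
* S. Floccari, *The Hodge and Tate conjectures for hyper-Kähler sixfolds of generalized Kummer type*
  (arXiv:2308.02267, 2023), §1 Outline: "The manifolds of `Kumⁿ`-type are by definition deformation
  equivalent to Beauville's generalized Kummer variety `Kⁿ(A)` on an abelian surface `A`"; §2.1:
  "`K³(A) := (Σ ∘ ν)⁻¹(0)`", `ν` the Hilbert–Chow morphism, `Σ` the summation map, "the composition
  `Σ ∘ ν : A^[4] → A` is an isotrivial fibration".
* S. Floccari, M. Varesco, *Algebraic cycles on hyper-Kähler varieties of generalized Kummer type*
  (arXiv:2308.04865, Math. Ann. 2024), §1: "`X` is a hyper-Kähler variety of generalized Kummer type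
  of dimension `2n` if it is a projective deformation of [the] `2n`-dimensional generalized Kummer
  variety. We will say that `X` is of `Kumⁿ`-type."
* J. S. Milne, *Jacobian Varieties* (1986), Prop. 6.4 / Remark 6.5 (the Albanese property through the
  difference map), as rendered points-free in the tree's `Motives.Jacobian`.

## Rendering (tree carriers) and design

The obstacle named in the scoping document is Beauville's morphism `S = Σ ∘ ν : A^[n+1] → A`: the
tree has Hilbert schemes of points by their universal property (`HilbertScheme.IsHilbertSchemeOfPoints`)
but neither the Hilbert–Chow morphism nor symmetric products.  We do NOT construct `S`.  Instead we
use the two printed facts quoted above — `S` is the ALBANESE map of `A^[n+1]` (`S_*` bijective on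
`π₁`) and `S` is ISOTRIVIAL (all its fibres are isomorphic to `K_n = S⁻¹(0)`) — and the tree's
points-free Albanese structure `Motives.Jacobian H` (an abelian variety `𝒜.J` with a difference map
`𝒜.diff : H ⊗ H ⟶ 𝒜.J.X`, `(x, y) ↦ alb(x) − alb(y)`, universal for morphisms `H ⊗ H → A'` trivial on
the diagonal; the structure is stated there for curves but its fields are the Albanese property of
any proper variety, by rigidity of morphisms from products into abelian varieties), which for
`H = A^[n+1]` is `(A, (x, y) ↦ S(x) − S(y))` up to unique isomorphism (`Jacobian.uniqueUpToIso`).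
Hence, for ANY point `x₀ ∈ H(ℂ)`, the scheme-theoretic fibre over `0` of
`s₀ := 𝒜.diff ∘ (id, x₀) : H → 𝒜.J.X`, `x ↦ alb(x) − alb(x₀)`, is `S⁻¹(S(x₀)) ≅ K_n(A)` (Beauville's
cartesian diagram: translation by `t` with `(n+1)t = S(x₀)` carries `S⁻¹(0)` isomorphically onto
`S⁻¹(S(x₀))`).  This gives:

* `IsGeneralizedKummerVarietyOf n A K` — **`K` is a generalized Kummer variety `Kⁿ(A)` of the abelian
  variety `A`**: there are a Hilbert scheme of `n + 1` points `(H, Ξ)` of `A.X` over `ℂ`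
  (`IsHilbertSchemeOfPoints (n + 1) A.X H Ξ`) which is smooth projective of dimension `2(n+1)`
  (`Motives.IsSmoothProjective (2 * (n + 1)) H` — Grothendieck/Fogarty for `A^[n+1]`, a theorem about
  the witness recorded as a clause, as in `IsOfK3HilbertType`), an Albanese datum `𝒜 : Motives.Jacobian H`,
  a point `x₀ : 𝟙_ ⟶ H` (`𝟙_ = Spec ℂ`), and a morphism `j : K ⟶ H` making `K` the PULL-BACK of the
  unit section `1 : 𝟙_ ⟶ 𝒜.J.X` along `s₀ = lift (𝟙 H) (toUnit H ≫ x₀) ≫ 𝒜.diff`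
  (`CategoryTheory.IsPullback j (toUnit K) s₀ 1`; pull-backs in `Over (Spec ℂ)` are fibre products of
  schemes, so `K` is the scheme-theoretic fibre `s₀⁻¹(0)`).
* `IsOfGeneralizedKummerType n X` — **`X` is of `Kumⁿ`-type**: there are an abelian SURFACE `A`
  (`A.dim = 2`) and a generalized Kummer variety `K` of `A` in the above sense, smooth projective of
  dimension `2n` (`Motives.IsSmoothProjective (2 * n) K`: Beauville §7 "`S` est lisse" and Théorème 4
  — again a theorem about the witness), with `X` deformation equivalent to `K` in dimension `2n`
  (`AreDeformationEquivalent (2 * n) K X`: chains of proper holomorphic submersions over connected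
  bases between analytifications, file `OGradySixType`).  As for `IsOfK3HilbertType`: no smoothness
  clause and no IHS clause ON `X` (companion hypothesis `Motives.IsSmoothProjective (2 * n) X` in every
  printed statement; IHS is a consequence, Beauville Théorème 4 with Prop. 9); abelian surfaces
  instead of Beauville's generic `2`-tori give the same deformation class (the class is connected and
  contains the `Kⁿ(A)` of abelian surfaces — Floccari's and Floccari–Varesco's wording quoted above
  takes `A` an abelian surface).

Junk analysis.  `∃ A, ∃ (H, Ξ), ∃ 𝒜` — were no Hilbert scheme or no Albanese datum to exist the
predicates are `False` (safe side); non-vacuity is `of_hodgeModel` below modulo those existence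
theorems.  The choice of `x₀` is immaterial by isotriviality (above).  Small `n`: `n = 1` gives the
deformations of the Kummer surface `K¹(A) = Km(A)` (Beauville: "`K₁` n'est autre que la surface de
Kummer"), i.e. K3 surfaces; `n = 0` gives `K⁰(A) = S⁻¹(0) ⊂ A^[1] = A`, a point.  Beauville's `b₂ = 7`
and the BBF lattice `U^{⊕3} ⊕ ⟨-2(n+1)⟩` are theorems about the class, not clauses.

## API (all proved)

`isGeneralizedKummerVarietyOf_iff`, `isOfGeneralizedKummerType_iff` (unfolding);
`IsGeneralizedKummerVarietyOf.exists_comm` (the fibre square commutes: `j ≫ s₀ = toUnit K ≫ 1`);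
`IsOfGeneralizedKummerType.of_areDeformationEquivalent_self`, `.of_hodgeModel` (**`Kⁿ(A)` itself is
of `Kumⁿ`-type** once it carries a Hodge model — non-vacuity modulo the existence theorems),
`.exists_abelianSurface`, `.exists_model` (symmetric form with the smooth projective model in hand).

## Not here (theorems to be cited AGAINST these definitions; no named facts are introduced)

Existence/projectivity/smoothness of `A^[n+1]` and of its Albanese; Beauville's Prop. 7–8 and
Théorème 4 (`Kⁿ(A)` is a projective IHS variety of dimension `2n`, simply connected, `b₂ = 7`); the
Hilbert–Chow morphism and the identification of `s₀⁻¹(0)` with `(Σ ∘ ν)⁻¹(0)`; monodromy and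
period theory of `Kumⁿ`-type (Markman 2023, Mongardi); the Hodge-conjecture theorems for `Kum²`/`Kum³`
(recorded as named facts in `Hyperkaehler/GeneralizedKummerTypeHodgeConjecture`).
-/

noncomputable section

open CategoryTheory MonoidalCategory CartesianMonoidalCategory
open Literature.AlgebraicGeometry.HilbertScheme

namespace Literature.AlgebraicGeometry.Hyperkaehler

open scoped MonObj

/-! ### Generalized Kummer varieties of an abelian variety -/

/-- **`K` is a generalized Kummer variety `Kⁿ(A)` of the abelian variety `A`** (Beauville 1983 §7:
`K_n = S⁻¹(0)` for the sum morphism `S : A^[n+1] → A`, which is smooth, isotrivial — "ses fibres sont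
isomorphes entre elles" — and the Albanese map of `A^[n+1]` — "`S_* : π₁(A^[n+1]) → π₁(A)` est
bijectif").  Points-free rendering (module docstring): a Hilbert scheme of `n + 1` points `(H, Ξ)` of
`A.X`, smooth projective of dimension `2(n+1)`, an Albanese datum `𝒜 : Motives.Jacobian H`
(difference map `𝒜.diff : H ⊗ H ⟶ 𝒜.J.X` with the Albanese universal property), a point
`x₀ : 𝟙_ ⟶ H`, and `j : K ⟶ H` exhibiting `K` as the fibre over the unit section of
`x ↦ alb(x) − alb(x₀)`, i.e. `K ≅ S⁻¹(S(x₀)) ≅ Kⁿ(A)`. [cite: Beauville1983, §7 p. 769 (definition of K_r, footnote 2) and Prop. 8]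
[cite: Milne1986JacobianVarieties, §6 Prop. 6.4 and Remark 6.5] -/
def IsGeneralizedKummerVarietyOf (n : ℕ) (A : Motives.AbelianVariety ℂ) (K : Motives.SchemeOver ℂ) :
    Prop :=
  ∃ (H : Motives.SchemeOver ℂ) (Ξ : (A.X ⊗ H).left.IdealSheafData) (𝒜 : Motives.Jacobian H)
    (x₀ : 𝟙_ (Motives.SchemeOver ℂ) ⟶ H) (j : K ⟶ H),
    IsHilbertSchemeOfPoints (n + 1) A.X H Ξ ∧ Motives.IsSmoothProjective (2 * (n + 1)) H ∧
      IsPullback j (toUnit K) (lift (𝟙 H) (toUnit H ≫ x₀) ≫ 𝒜.diff)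
        (1 : 𝟙_ (Motives.SchemeOver ℂ) ⟶ 𝒜.J.X)

/-- **`X` is of `Kumⁿ`-type** (Floccari 2023 §1: "The manifolds of `Kumⁿ`-type are by definition
deformation equivalent to Beauville's generalized Kummer variety `Kⁿ(A)` on an abelian surface `A`";
Floccari–Varesco 2024 §1).  For a `ℂ`-scheme `X`: there are an abelian surface `A` (`A.dim = 2`) and a
generalized Kummer variety `K` of `A` (`IsGeneralizedKummerVarietyOf n A K`), smooth projective of
dimension `2n` (Beauville §7, Théorème 4 — a theorem about the witness), with `X` deformation
equivalent to `K` in dimension `2n` (`AreDeformationEquivalent (2 * n) K X`).  No smoothness or IHS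
clause ON `X` (companion hypothesis, resp. consequence; see the module docstring for the reading,
abelian surfaces versus `2`-tori, and small `n`). [cite: Floccari2023, §1 (Outline) and §2.1]
[cite: FloccariVaresco2024, §1] [cite: Beauville1983, §7 Théorème 4 (p. 771)] -/
def IsOfGeneralizedKummerType (n : ℕ) (X : Motives.SchemeOver ℂ) : Prop :=
  ∃ (A : Motives.AbelianVariety ℂ) (K : Motives.SchemeOver ℂ), A.dim = 2 ∧
    IsGeneralizedKummerVarietyOf n A K ∧ Motives.IsSmoothProjective (2 * n) K ∧
      AreDeformationEquivalent (2 * n) K X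

variable {n : ℕ} {X : Motives.SchemeOver ℂ}

/-- Unfolding lemma. [cite: Beauville1983, §7 p. 769] -/
theorem isGeneralizedKummerVarietyOf_iff {A : Motives.AbelianVariety ℂ} {K : Motives.SchemeOver ℂ} :
    IsGeneralizedKummerVarietyOf n A K ↔
      ∃ (H : Motives.SchemeOver ℂ) (Ξ : (A.X ⊗ H).left.IdealSheafData) (𝒜 : Motives.Jacobian H)
        (x₀ : 𝟙_ (Motives.SchemeOver ℂ) ⟶ H) (j : K ⟶ H),
        IsHilbertSchemeOfPoints (n + 1) A.X H Ξ ∧ Motives.IsSmoothProjective (2 * (n + 1)) H ∧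
          IsPullback j (toUnit K) (lift (𝟙 H) (toUnit H ≫ x₀) ≫ 𝒜.diff)
            (1 : 𝟙_ (Motives.SchemeOver ℂ) ⟶ 𝒜.J.X) :=
  Iff.rfl

/-- Unfolding lemma. [cite: Floccari2023, §1 (Outline)] -/
theorem isOfGeneralizedKummerType_iff : IsOfGeneralizedKummerType n X ↔
    ∃ (A : Motives.AbelianVariety ℂ) (K : Motives.SchemeOver ℂ), A.dim = 2 ∧
      IsGeneralizedKummerVarietyOf n A K ∧ Motives.IsSmoothProjective (2 * n) K ∧
        AreDeformationEquivalent (2 * n) K X :=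
  Iff.rfl

namespace IsGeneralizedKummerVarietyOf

/-- The fibre square of a generalized Kummer variety commutes: on `K`, `alb(x) − alb(x₀) = 0`
(`K ⊂ S⁻¹(S(x₀))`). [cite: Beauville1983, §7 p. 769] -/
theorem exists_comm {A : Motives.AbelianVariety ℂ} {K : Motives.SchemeOver ℂ}
    (h : IsGeneralizedKummerVarietyOf n A K) :
    ∃ (H : Motives.SchemeOver ℂ) (𝒜 : Motives.Jacobian H) (x₀ : 𝟙_ (Motives.SchemeOver ℂ) ⟶ H)
      (j : K ⟶ H), j ≫ (lift (𝟙 H) (toUnit H ≫ x₀) ≫ 𝒜.diff) =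
        toUnit K ≫ (1 : 𝟙_ (Motives.SchemeOver ℂ) ⟶ 𝒜.J.X) := by
  obtain ⟨H, -, 𝒜, x₀, j, -, -, hsq⟩ := h
  exact ⟨H, 𝒜, x₀, j, hsq.w⟩

/-- The ambient Hilbert scheme `A^[n+1]` of a generalized Kummer variety is smooth projective of
dimension `2(n+1)` (clause of the definition; Fogarty/Grothendieck for `A^[n+1]`).
[cite: Beauville1983, §6 propriétés (a)–(b) and §7] -/
theorem exists_isSmoothProjective_hilbert {A : Motives.AbelianVariety ℂ} {K : Motives.SchemeOver ℂ}
    (h : IsGeneralizedKummerVarietyOf n A K) :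
    ∃ (H : Motives.SchemeOver ℂ) (Ξ : (A.X ⊗ H).left.IdealSheafData),
      IsHilbertSchemeOfPoints (n + 1) A.X H Ξ ∧ Motives.IsSmoothProjective (2 * (n + 1)) H := by
  obtain ⟨H, Ξ, -, -, -, hH, hHs, -⟩ := h
  exact ⟨H, Ξ, hH, hHs⟩

end IsGeneralizedKummerVarietyOf

namespace IsOfGeneralizedKummerType

/-- **`Kⁿ(A)` is of `Kumⁿ`-type** as soon as it is smooth projective of dimension `2n` and
deformation equivalent to itself (which holds once it carries a Hodge model, `of_hodgeModel`).
[cite: Floccari2023, §1 (Outline)] [cite: Beauville1983, §7 Théorème 4] -/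
theorem of_areDeformationEquivalent_self {A : Motives.AbelianVariety ℂ} {K : Motives.SchemeOver ℂ}
    (hA : A.dim = 2) (hK : IsGeneralizedKummerVarietyOf n A K)
    (hKs : Motives.IsSmoothProjective (2 * n) K) (hself : AreDeformationEquivalent (2 * n) K K) :
    IsOfGeneralizedKummerType n K :=
  ⟨A, K, hA, hK, hKs, hself⟩

/-- **Non-vacuity (modulo the existence of `A^[n+1]`, of its Albanese, and Beauville's smoothness)**:
a smooth projective generalized Kummer variety of an abelian surface carrying a Hodge model is of
`Kumⁿ`-type — by the constant family over a point (`areDeformationEquivalent_self`; `K` is proper,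
being projective). [cite: Beauville1983, §7 Théorème 4] [cite: Kodaira2005, §2.3 (trivial family)] -/
theorem of_hodgeModel {A : Motives.AbelianVariety ℂ} {K : Motives.SchemeOver ℂ} (hA : A.dim = 2)
    (hK : IsGeneralizedKummerVarietyOf n A K) (hKs : Motives.IsSmoothProjective (2 * n) K)
    (M : HodgeTheory.HodgeModel (2 * n) K) : IsOfGeneralizedKummerType n K :=
  haveI : AlgebraicGeometry.IsProper K.hom := hKs.isProjectiveOver.isProper
  of_areDeformationEquivalent_self hA hK hKs (areDeformationEquivalent_self M)

/-- A manifold of `Kumⁿ`-type comes with an abelian surface. [cite: Floccari2023, §1 (Outline)] -/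
theorem exists_abelianSurface (h : IsOfGeneralizedKummerType n X) :
    ∃ A : Motives.AbelianVariety ℂ, A.dim = 2 := by
  obtain ⟨A, -, hA, -⟩ := h
  exact ⟨A, hA⟩

/-- A manifold of `Kumⁿ`-type is deformation equivalent to a smooth projective generalized Kummer
variety `Kⁿ(A)` of an abelian surface (symmetric form of the definition, with the model's
properness and local finite type in hand). [cite: Floccari2023, §1 (Outline)]
[cite: Beauville1983, §7 Théorème 4] -/
theorem exists_model (h : IsOfGeneralizedKummerType n X) :
    ∃ (A : Motives.AbelianVariety ℂ) (K : Motives.SchemeOver ℂ), A.dim = 2 ∧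
      IsGeneralizedKummerVarietyOf n A K ∧ Motives.IsSmoothProjective (2 * n) K ∧
        AlgebraicGeometry.IsProper K.hom ∧ AlgebraicGeometry.LocallyOfFiniteType K.hom ∧
          AreDeformationEquivalent (2 * n) X K := by
  obtain ⟨A, K, hA, hK, hKs, hd⟩ := h
  haveI := hKs.smoothOfRelativeDimension
  haveI : AlgebraicGeometry.Smooth K.hom :=
    AlgebraicGeometry.SmoothOfRelativeDimension.smooth (2 * n) _
  exact ⟨A, K, hA, hK, hKs, hKs.isProjectiveOver.isProper, inferInstance, hd.symm⟩

end IsOfGeneralizedKummerType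

/-- **`X` is of `Kum²`-type** (generalized Kummer fourfolds; Floccari–Varesco 2024 Cor. 1.2,
Hassett–Tschinkel 2013). [cite: FloccariVaresco2024, §1 Cor. 1.2] -/
abbrev IsOfGeneralizedKummerFourfoldType (X : Motives.SchemeOver ℂ) : Prop :=
  IsOfGeneralizedKummerType 2 X

/-- **`X` is of `Kum³`-type** (generalized Kummer sixfolds; Floccari 2023 Thm. 1.1).
[cite: Floccari2023, Thm. 1.1 and §2.1] -/
abbrev IsOfGeneralizedKummerSixfoldType (X : Motives.SchemeOver ℂ) : Prop :=
  IsOfGeneralizedKummerType 3 X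

end Literature.AlgebraicGeometry.Hyperkaehler

end
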